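import Mathlib

/-!
# Crux `HilbertIntegralOverconvergentIsCongruence` (stmt-Langlands-8485), line `Sketch-ideate-r1-k1`:
# the `d`-free Katz–Sturm lever (`p`-adic Schwarz lemma at the cusp in an abstract `q`-expansion ring)

The LEVER of idea `sturm-slope-engine` — "an integral Sturm bound fed through the Katz expansion on the
strict neighbourhood `{|E| ≥ p^{-r}}` is a `p`-adic Schwarz lemma at the cusp" — is pure ultrametric
algebra once three inputs are named: (i) a sup-norm Sturm principle for the space `V` in which the Katz
truncation lives, on a finite window `W` of exponents; (ii) an integral lift `e` of (a power of) the Hasse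
invariant with constant term `1` (so `e⁻¹` is integral as well); (iii) a Katz datum `a_i` with
`‖a_i‖ ≤ C ρ^i`.  This file proves it in that generality, for formal power series in ANY set of
variables `σ` over ANY nonarchimedean normed field `K` (`MvPowerSeries σ K`), with vanishing imposed on an
arbitrary LOWER SET `D ⊇ W` of exponents and the conclusion `‖G_n‖ ≤ C ρ^{M+1}` for ALL exponents `n`:
this is the form the Hilbert engine instantiates (the `q`-expansion ring of Hilbert modular forms over a
totally real `F` of degree `d` embeds coefficientwise in `MvPowerSeries (Fin d) K` via
`ν ↦ (Tr(λ_j ν))_j` for a trace-dual totally positive basis `λ`; `V` = expansions of classical forms of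
the weight of the `M`-th truncation, `W` = its Hilbert Sturm window, `e` = the Hasse lift), and its
one-variable case `σ = Unit`, `K = ℚ̄_p`, `ρ = p^{-r}` is the line's `d = 1` shadow
(`sturmSchwarzShadow_of_sturmLine`).  The two elementary inputs (ultrametric product rule, integrality
of inverses in `MvPowerSeries σ K`) enter as hypotheses `hmul`, `hinv` — registered stubs
`stub_mvCoeffMulBound`, `stub_mvCoeffInvBound` of the line, landed separately.  Theorems only, no `sorry`.
-/

set_option linter.dupNamespace false

noncomputable section

namespace Summit.Langlands.Langlands.Theorems.HilbertIntegralOverconvergentIsCongruence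

open MvPowerSeries in
/-- **The `d`-free Katz–Sturm lever (registered stub `stub_katzSturmAbstract`).**  Let `K` be a
nonarchimedean normed field and `σ` any set of variables; assume the ultrametric product rule (`hmul`)
and the integrality of inverses of integral series with constant term `1` (`hinv`) in `MvPowerSeries σ K`.
Let `V` be a set of series satisfying the sup-norm Sturm principle on the window `W` (`hSturm`:
`T ∈ V` with `‖T_n‖ ≤ B` for `n ∈ W` has `‖T_n‖ ≤ B` for all `n`), `e` an integral series with constant
term `1` (the Hasse lift), `a_i` a Katz datum with `‖(a_i)_n‖ ≤ C ρ^i` (`0 ≤ ρ ≤ 1`, `0 ≤ C`) whose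
`M`-th truncation `Σ_{i ≤ M} a_i e^{M-i}` lies in `V`, and `G` the Katz sum, `G_n = Σ_i (a_i e^{-i})_n`.
If `G_n = 0` for all `n` in a lower set `D ⊇ W` of exponents, then `‖G_n‖ ≤ C ρ^{M+1}` for EVERY `n`.
(Proof: `G e^M = T + tail`, `‖tail‖ ≤ C ρ^{M+1}`; `G e^M` vanishes on `D`, so `T` is small on `W`, hence
everywhere by Sturm; so `G e^M` is small everywhere, and `G = (G e^M) e^{-M}` with `e^{-M}` integral.)
[folklore] -/
theorem stub_katzSturmAbstract {K σ : Type*} [NormedField K] [IsUltrametricDist K]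
    (hmul : ∀ (φ ψ : MvPowerSeries σ K) (A B : ℝ), 0 ≤ A → 0 ≤ B →
      (∀ n, ‖coeff n φ‖ ≤ A) → (∀ n, ‖coeff n ψ‖ ≤ B) → ∀ n, ‖coeff n (φ * ψ)‖ ≤ A * B)
    (hinv : ∀ φ : MvPowerSeries σ K, constantCoeff φ = 1 →
      (∀ n, ‖coeff n φ‖ ≤ 1) → ∀ n, ‖coeff n φ⁻¹‖ ≤ 1)
    (V : Set (MvPowerSeries σ K)) (W : Set (σ →₀ ℕ))
    (hSturm : ∀ T ∈ V, ∀ B : ℝ, 0 ≤ B → (∀ n ∈ W, ‖coeff n T‖ ≤ B) → ∀ n, ‖coeff n T‖ ≤ B)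
    (e : MvPowerSeries σ K) (he0 : constantCoeff e = 1) (he : ∀ n, ‖coeff n e‖ ≤ 1)
    (a : ℕ → MvPowerSeries σ K) (ρ C : ℝ) (hρ : 0 ≤ ρ) (hρ1 : ρ ≤ 1) (hC : 0 ≤ C)
    (ha : ∀ i n, ‖coeff n (a i)‖ ≤ C * ρ ^ i)
    (M : ℕ) (htrunc : (∑ i ∈ Finset.range (M + 1), a i * e ^ (M - i)) ∈ V)
    (G : MvPowerSeries σ K)
    (hG : ∀ n, HasSum (fun i : ℕ ↦ coeff n (a i * e⁻¹ ^ i)) (coeff n G))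
    (D : Set (σ →₀ ℕ)) (hD : IsLowerSet D) (hvan : ∀ n ∈ D, coeff n G = 0) (hWD : W ⊆ D) :
    ∀ n, ‖coeff n G‖ ≤ C * ρ ^ (M + 1) := by
  classical
  -- the inverse `e'` of the Hasse lift is integral, and so are its powers
  set e' : MvPowerSeries σ K := e⁻¹ with he'_def
  have hee' : e * e' = 1 := MvPowerSeries.mul_inv_cancel e (by rw [he0]; exact one_ne_zero)
  have he'_int : ∀ n, ‖coeff n e'‖ ≤ 1 := hinv e he0 he
  have hone : ∀ n : σ →₀ ℕ, ‖coeff n (1 : MvPowerSeries σ K)‖ ≤ 1 := fun n ↦ by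
    rw [coeff_one]
    split_ifs
    · rw [norm_one]
    · rw [norm_zero]; exact zero_le_one
  have he'pow : ∀ (s : ℕ) n, ‖coeff n (e' ^ s)‖ ≤ 1 := by
    intro s
    induction s with
    | zero => simpa only [pow_zero] using hone
    | succ s ih =>
        intro n
        rw [pow_succ]
        simpa only [mul_one] using hmul _ _ 1 1 zero_le_one zero_le_one ih he'_int n
  -- Step A: coefficientwise `G · e^M = Σ_i (a_i e'^i) e^M`.
  have hA : ∀ n, HasSum (fun i : ℕ ↦ coeff n (a i * e' ^ i * e ^ M)) (coeff n (G * e ^ M)) := by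
    intro n
    have hsum : ∀ x ∈ Finset.HasAntidiagonal.antidiagonal n, HasSum
        (fun i : ℕ ↦ coeff x.1 (a i * e' ^ i) * coeff x.2 (e ^ M))
        (coeff x.1 G * coeff x.2 (e ^ M)) := fun x _ ↦ (hG x.1).mul_right _
    have key : ∀ i : ℕ, coeff n (a i * e' ^ i * e ^ M) =
        ∑ x ∈ Finset.HasAntidiagonal.antidiagonal n, coeff x.1 (a i * e' ^ i) * coeff x.2 (e ^ M) :=
      fun i ↦ coeff_mul n _ _
    rw [coeff_mul]
    simp_rw [key]
    exact hasSum_sum hsum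
  -- Step B: split the Katz expansion at `i = M`: `G e^M = T + tail` coefficientwise.
  have hsplit_le : ∀ i ≤ M, a i * e' ^ i * e ^ M = a i * e ^ (M - i) := by
    intro i hi
    obtain ⟨d, rfl⟩ := Nat.exists_eq_add_of_le hi
    rw [Nat.add_sub_cancel_left, pow_add, mul_assoc, ← mul_assoc (e' ^ i), ← mul_pow,
      mul_comm e' e, hee', one_pow, one_mul]
  have hsplit_gt : ∀ j : ℕ, a (j + (M + 1)) * e' ^ (j + (M + 1)) * e ^ M =
      a (j + (M + 1)) * e' ^ (j + 1) := by
    intro j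
    rw [show j + (M + 1) = (j + 1) + M by ring, pow_add, mul_assoc, mul_assoc, ← mul_pow,
      mul_comm e' e, hee', one_pow, mul_one]
  set T : MvPowerSeries σ K := ∑ i ∈ Finset.range (M + 1), a i * e ^ (M - i) with hT_def
  have hTcoeff : ∀ n, coeff n T = ∑ i ∈ Finset.range (M + 1), coeff n (a i * e ^ (M - i)) :=
    fun n ↦ by rw [hT_def, map_sum]
  have hB : ∀ n, HasSum (fun j : ℕ ↦ coeff n (a (j + (M + 1)) * e' ^ (j + 1)))
      (coeff n (G * e ^ M) - coeff n T) := by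
    intro n
    have h1 := (hasSum_nat_add_iff' (M + 1)).mpr (hA n)
    have h2 : ∑ i ∈ Finset.range (M + 1), coeff n (a i * e' ^ i * e ^ M) =
        ∑ i ∈ Finset.range (M + 1), coeff n (a i * e ^ (M - i)) :=
      Finset.sum_congr rfl fun i hi ↦ by
        rw [hsplit_le i (Nat.lt_succ_iff.mp (Finset.mem_range.mp hi))]
    rw [h2, ← hTcoeff n] at h1
    simp_rw [hsplit_gt] at h1
    exact h1
  -- Step C: the tail is small: `‖tail_n‖ ≤ C ρ^{M+1}` (ultrametric `tsum` bound).
  have hCn : ∀ n, ‖coeff n (G * e ^ M) - coeff n T‖ ≤ C * ρ ^ (M + 1) := by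
    intro n
    rw [← (hB n).tsum_eq]
    refine IsUltrametricDist.norm_tsum_le_of_forall_le_of_nonneg (by positivity) fun j ↦ ?_
    calc ‖coeff n (a (j + (M + 1)) * e' ^ (j + 1))‖
        ≤ C * ρ ^ (j + (M + 1)) * 1 :=
          hmul _ _ _ _ (by positivity) zero_le_one (ha _) (he'pow _) n
      _ ≤ C * ρ ^ (M + 1) := by
          rw [mul_one]
          exact mul_le_mul_of_nonneg_left (pow_le_pow_of_le_one hρ hρ1 (Nat.le_add_left _ _)) hC
  -- Step D: on the lower set `D` the product `G e^M` has vanishing coefficients.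
  have hDvan : ∀ n ∈ D, coeff n (G * e ^ M) = 0 := by
    intro n hn
    rw [coeff_mul]
    refine Finset.sum_eq_zero fun x hx ↦ ?_
    have hx' : x.1 + x.2 = n := Finset.HasAntidiagonal.mem_antidiagonal.mp hx
    have hx1 : x.1 ∈ D := hD (show x.1 ≤ n from hx' ▸ le_self_add) hn
    rw [hvan x.1 hx1, zero_mul]
  -- Step E: Sturm applied to the truncation `T ∈ V`: small on the window, hence everywhere.
  have hTsmall : ∀ n, ‖coeff n T‖ ≤ C * ρ ^ (M + 1) := by
    refine hSturm T htrunc _ (by positivity) fun n hn ↦ ?_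
    have := hCn n
    rwa [hDvan n (hWD hn), zero_sub, norm_neg] at this
  -- Step F: `G e^M = tail + T` is small everywhere, and `G = (G e^M) · e'^M`.
  have hGe : ∀ n, ‖coeff n (G * e ^ M)‖ ≤ C * ρ ^ (M + 1) := fun n ↦ by
    rw [← sub_add_cancel (coeff n (G * e ^ M)) (coeff n T)]
    exact (IsUltrametricDist.norm_add_le_max _ _).trans (max_le (hCn n) (hTsmall n))
  have hGeq : G = G * e ^ M * e' ^ M := by
    rw [mul_assoc, ← mul_pow, hee', one_pow, mul_one]
  intro n
  rw [hGeq]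
  simpa only [mul_one] using hmul _ _ _ 1 (by positivity) zero_le_one hGe (he'pow M) n

end Summit.Langlands.Langlands.Theorems.HilbertIntegralOverconvergentIsCongruence

end
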